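import Summits.HodgeConjecture.HodgeConjecture.Theorems.PeriodsPoliceClassicalBridgeBettiHardLefschetz
import Summits.HodgeConjecture.HodgeConjecture.Theses.MomentAmplification
import Literature.AlgebraicGeometry.Motives.CorrespondencesAlgebraicOperators
import Literature.AlgebraicGeometry.Motives.CorrespondencesTraceFormula
import Literature.AlgebraicGeometry.Motives.CharpolyOfRationalTraces
import HarnessLib

/-!
# Crux `LefschetzBetti` (stmt-HodgeConjecture-11036), line `birth` — stub 1 `stub_hardLefschetz`, and the crux
# REDUCED to `C(X)` and `η`-free algebraic isomorphisms

Route `HodgeConjecture/MomentAmplification`, crux #3 `LefschetzBetti` (Grothendieck's `B(X)/ℂ` in `θ`-form for the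
Weil cohomology `B.W` of every comparison-compatible Betti–Hodge realization `B`); registered skeleton
`Cruxes/LefschetzBetti/Lines/birth.lean` (`LefschetzBetti_of` from `stub_hardLefschetz`, `stub_kunnethProjector`,
`stub_algebraicIso` through the sorry-free glue `standardConjectureB_of_algebraicIso`). This file

* closes the registered stub **`stub_hardLefschetz`** (signature VERBATIM): hard Lefschetz for `B.W` of every
  comparison-compatible `B` — a one-term application of `Theorems.ClassicalBridge.bettiHardLefschetz` (file
  `PeriodsPoliceClassicalBridgeBettiHardLefschetz`, which proves it for EVERY `B : BettiHodgeData ℂ`; the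
  compatibility guard is idle for this stub);
* re-runs the skeleton's glue (Lieberman's Cayley–Hamilton lemma `standardConjectureB_of_algebraicIso`, adapted
  verbatim from the registered skeleton, Kleiman 1968 §2 / Kleiman 1994 Thm. 4-1) with stub 1 discharged:
  **`lefschetzBetti_of_kunnethProjector_of_algebraicIso`** — the crux `Theses.MomentAmplification.LefschetzBetti` BY
  NAME from the two remaining registered stubs `stub_kunnethProjector` (`C(X)/ℂ`: the Künneth projectors
  `πⁱ = [id_{Hⁱ}]` of `B.W` are algebraic) and `stub_algebraicIso` (for `i + r = n` SOME algebraic correspondence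
  induces SOME linear isomorphism `H²ⁿ⁻ⁱ(X) ⥲ Hⁱ(X)`), both OPEN (standard conjectures); so the crux is reduced in
  the kernel to `C ∧ QI`.

No case of `B(X)` or `C(X)` is claimed; no definition, no named fact, no sorry. References: [Kleiman1968] §1.4, §2;
[Kleiman1994] §4 Thm. 4-1; [Lieberman1968]; [VoisinHodgeI2002] Thm. 6.25.
-/

noncomputable section

-- every declaration of this problem lives in `Summit.HodgeConjecture.HodgeConjecture.…` (summit = sub-problem)
set_option linter.dupNamespace false

open CategoryTheory AlgebraicGeometry
open Literature.AlgebraicGeometry.Motives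

namespace Summit.HodgeConjecture.HodgeConjecture.Theorems.LefschetzBetti

universe u v

/-- **Stub `stub_hardLefschetz` of crux `LefschetzBetti` (registered signature, verbatim):** hard Lefschetz for the
Weil cohomology `B.W` of every comparison-compatible Betti–Hodge realization datum `B` over `ℂ` — for `X` smooth
projective of dimension `n`, every hyperplane class `η` and `i + r = n`, `Lʳ : Hⁱ(X) → Hⁱ⁺²ʳ(X)` is bijective
(Voisin I Thm. 6.25 transported along `B.iso`; the tree's `Theorems.ClassicalBridge.bettiHardLefschetz`, valid for
every `B`, the guard being idle). [cite: VoisinHodgeI2002, Thm. 6.25] [cite: Kleiman1968, §1.4] -/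
theorem stub_hardLefschetz :
    ∀ B : BettiHodgeData ℂ, B.IsComparisonCompatible → B.W.HasHardLefschetz :=
  fun B _ ↦ ClassicalBridge.bettiHardLefschetz B

-- adapted verbatim from the registered skeleton `Cruxes/LefschetzBetti/Lines/birth.lean` (sorry-free glue there)
/-- **`B(X, η)` from hard Lefschetz, algebraic Künneth projectors and `η`-free algebraic isomorphisms**
(Kleiman 1968 §2; Kleiman 1994 §4, Thm. 4-1; Lieberman 1968): for a Weil cohomology `W` with coefficients of
characteristic `0`, `X` smooth projective of dimension `n` and a hyperplane class `η` such that every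
`Lʳ_η : Hⁱ → H²ⁿ⁻ⁱ` (`i + r = n`) is bijective, every `id_{Hⁱ(X)}` is induced by an algebraic correspondence, and for
every `i + r = n` some algebraic correspondence induces a linear isomorphism `H²ⁿ⁻ⁱ(X) ⥲ Hⁱ(X)`, the standard
conjecture `B(X, η)` holds in `θ`-form: `θ := w⁻¹ ∘ u` with `w := u ∘ Lʳ_η`, `w⁻¹ ∈ ℚ[w]` by Cayley–Hamilton and the
rationality of the traces of the algebraic operators `wᵐ`. [cite: Kleiman1968, §2] [cite: Kleiman1994, §4 Thm. 4-1] -/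
theorem standardConjectureB_of_algebraicIso {k : Type u} [Field k] {K : Type v} [Field K]
    [CharZero K] (W : WeilCohomology k K) {n : ℕ} {X : SchemeOver k}
    (hX : IsSmoothProjective n X) {η : W.obj X 2} (hη : W.IsHyperplaneClass X η)
    (hL : ∀ (i r j : ℕ), i + r = n → ∀ h : i + 2 * r = j,
      Function.Bijective (W.lefschetzPow X η r i j h))
    (hC : ∀ i : ℕ, W.IsAlgebraicOperator n n (LinearMap.id : W.obj X i →ₗ[K] W.obj X i))
    (hQI : ∀ (i r j : ℕ), i + r = n → i + 2 * r = j →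
      ∃ u : W.obj X j →ₗ[K] W.obj X i, Function.Bijective u ∧ W.IsAlgebraicOperator n n u) :
    W.StandardConjectureB n X η := by
  intro i r j h₁ h₂
  -- the three inputs in bidegree `(j, i)`
  obtain ⟨u, hubij, hualg⟩ := hQI i r j h₁ h₂
  have hid : W.IsAlgebraicOperator n n (LinearMap.id : W.obj X i →ₗ[K] W.obj X i) := hC i
  have hbij : Function.Bijective (W.lefschetzPow X η r i j h₂) := hL i r j h₁ h₂
  -- `w = u ∘ Lʳ_η` is an algebraic automorphism of `Hⁱ(X)`
  set w : W.obj X i →ₗ[K] W.obj X i := u ∘ₗ W.lefschetzPow X η r i j h₂ with hw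
  have walg : W.IsAlgebraicOperator n n w := hualg.comp_lefschetzPow hX hX hη h₂
  have hunit : IsUnit w := (Module.End.isUnit_iff w).mpr (hubij.comp hbij)
  -- the powers of `w` are algebraic (uses `πⁱ` algebraic), hence have rational traces
  haveI := W.finite_obj hX i
  have htr : ∀ m : ℕ, ∃ q : ℚ, LinearMap.trace K _ (w ^ (m + 1)) = q := fun m ↦
    W.exists_rat_trace_of_isAlgebraicOperator hX (walg.pow hX hid (m + 1))
  -- Cayley–Hamilton: `w⁻¹ = ∑ qₘ wᵐ`, `qₘ ∈ ℚ`, is algebraic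
  obtain ⟨q, hv, -⟩ := LinearMap.exists_inverse_eq_sum_ratCast_smul_pow w hunit htr
  set v : W.obj X i →ₗ[K] W.obj X i :=
    ∑ m ∈ Finset.range (Module.finrank K (W.obj X i)), ((q m : ℚ) : K) • w ^ m with hv'
  have valg : W.IsAlgebraicOperator n n v :=
    PreWeilCohomology.IsAlgebraicOperator.sum_ratCast_smul _ q fun m _ ↦ walg.pow hX hid m
  -- `θ = w⁻¹ ∘ u` is the algebraic two-sided inverse of `Lʳ_η`
  have hleft : (v ∘ₗ u) ∘ₗ W.lefschetzPow X η r i j h₂ = LinearMap.id := by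
    rw [LinearMap.comp_assoc, ← hw, ← Module.End.mul_eq_comp, hv, Module.End.one_eq_id]
  refine ⟨v ∘ₗ u, ⟨h₁, hleft, ?_⟩, valg.comp hX hX hX hualg⟩
  refine LinearMap.ext fun y ↦ ?_
  obtain ⟨x, rfl⟩ := hbij.2 y
  have hx := LinearMap.congr_fun hleft x
  simp only [LinearMap.comp_apply, LinearMap.id_apply] at hx ⊢
  rw [hx]

/-- **Crux `LefschetzBetti` reduced to `C(X)` and `η`-free algebraic isomorphisms** (the registered skeleton's
composition `LefschetzBetti_of` run with stub 1 DISCHARGED by `stub_hardLefschetz`): if, for every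
comparison-compatible `B` and every smooth projective `X`, (`C(X)/ℂ`) each `id_{Hⁱ(X)}` is induced by an algebraic
correspondence with `ℚ`-coefficients — the registered stub `stub_kunnethProjector` — and (`QI(X)`) for every
`i + r = n`, `i + 2r = j` SOME algebraic correspondence induces SOME linear isomorphism `Hʲ(X) ⥲ Hⁱ(X)` — the
registered stub `stub_algebraicIso` — then the crux
`Summit.HodgeConjecture.HodgeConjecture.Theses.MomentAmplification.LefschetzBetti` holds (Grothendieck's `B(X)/ℂ` in
`θ`-form for every compatible `B.W`), by Lieberman's Cayley–Hamilton lemma `standardConjectureB_of_algebraicIso`.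
Both hypotheses are OPEN standard conjectures (Kleiman 1968 §2: `C(X)`, and the `η`-free form of `B(X)` that
Lieberman verified for abelian varieties); nothing unconditional about `B` or `C` is claimed.
[cite: Kleiman1968, §2] [cite: Kleiman1994, §4 Thm. 4-1] -/
theorem lefschetzBetti_of_kunnethProjector_of_algebraicIso
    (hC : ∀ B : BettiHodgeData ℂ, B.IsComparisonCompatible →
      ∀ ⦃n : ℕ⦄ ⦃X : SchemeOver ℂ⦄, IsSmoothProjective n X →
        ∀ i : ℕ, B.W.IsAlgebraicOperator n n (LinearMap.id : B.W.obj X i →ₗ[ℚ] B.W.obj X i))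
    (hQI : ∀ B : BettiHodgeData ℂ, B.IsComparisonCompatible →
      ∀ ⦃n : ℕ⦄ ⦃X : SchemeOver ℂ⦄, IsSmoothProjective n X →
        ∀ (i r j : ℕ), i + r = n → i + 2 * r = j →
          ∃ u : B.W.obj X j →ₗ[ℚ] B.W.obj X i,
            Function.Bijective u ∧ B.W.IsAlgebraicOperator n n u) :
    Summit.HodgeConjecture.HodgeConjecture.Theses.MomentAmplification.LefschetzBetti := by
  intro B hc n X hX η hη
  exact standardConjectureB_of_algebraicIso B.W hX hη (stub_hardLefschetz B hc hX η hη)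
    (hC B hc hX) (hQI B hc hX)

end Summit.HodgeConjecture.HodgeConjecture.Theorems.LefschetzBetti

end
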